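import Summits.AtomisticToContinuum.HydrodynamicLimit.Theses.OneFlightGossipEngine
import Summits.AtomisticToContinuum.HydrodynamicLimit.Theses.BGEndpointRigidity
import Summits.AtomisticToContinuum.HydrodynamicLimit.Theorems.OneFlightGossipEngineCollisionActivityTailsActMeasurable
import HarnessLib

/-!
# `CollisionActivityTails` (stmt-AtomisticToContinuum-13734), line `plaque-thinning-count-ld`, stub 5 (abnormal activity):
the hot and the tagged halves as local statements, and the reduction of stub 5' to them

Helper file (`--supports stmt-AtomisticToContinuum-13734`) for the crux
`Summit.AtomisticToContinuum.HydrodynamicLimit.Theses.OneFlightGossipEngine.CollisionActivityTails`, line `plaque-thinning-count-ld`,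
stub 5 — registered as `stub_abnormalActivityVanishes : PreShockEnvelope → AbnormalActivityVanishes`, re-typed LOCALLY by the lead
(cycle-1 reshape, `…PlaqueSplitDilute`) as `AbnormalFromEnvelope`: for ONE profile triple, diameter and flow family, an envelope
`EnvelopeOn σ a₀ θ₀ u₀ Φ t₁ β C` (a.e. Gaussian-weighted bounds `C^k e^{-β E_k}` of all bounded-order marginals of the transported
canonical density at times `r ≤ t₁`) with dilute constants gives `AbnormalSmallOn σ a₀ θ₀ u₀ Φ t` (the TAGGED cold activity and the
HOT activity of the window `(s, s + w]`, `w = τ (N+1)^{-1/3}`, `s ≤ t < t₁`, are small in mean under the local Gibbs law, uniformly in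
`τ`, with a tagging threshold `y₀ ≤ 1/σ³`). Vocabulary `tagAct`, `hotAct`, `Tagged` of `…Theorems.CollisionActivityTailsPlaqueSplit`.

* §2 the two halves as statements: `HotSmallOn` (the normalised hot activity is dominated a.e. by a measurable function of mean `≤ η` —
  the shape the window inequality of `…CollisionActivityTailsWindowFlux` delivers), `TaggedSmallOn` (with the dense-phase range
  `y₀ σ³ ≤ 1`), and their envelope forms `HotFromEnvelope` (no diluteness needed) and `TaggedFromEnvelope` (typed against the
  β-aware diluteness clause `C(2π/β)^{3/2}σ³ max(1,β⁻¹) ≤ κ₅` of `AbnormalFromEnvelope` — the kinetic-tag series needs the `β⁻¹`);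
* §3 `abnormalSmallOn_of_hot_of_tagged : 0 ≤ σ → HotSmallOn … t → TaggedSmallOn … t → AbnormalSmallOn … t` and
  the REGISTERED `stub_abnormalFromEnvelope_of_hot_of_tagged : HotFromEnvelope → TaggedFromEnvelope → AbnormalFromEnvelope` — PROVED (quantifier
  bookkeeping and one `lintegral` split by the measurable hot majorant; no measurability of the tagged sum is needed).

The hot half is carried further in `…CollisionActivityTailsAbnormalActivityStatics` / `…AbnormalActivityHot`
(`hotSmallOn_of_pairEnvelopeOn`, PROVED from a pair-law envelope of the laws at times `≤ t₁` by the window inequality); what remains of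
it is the static passage from `EnvelopeOn` (order `k = 2`) to the pair-law envelope. The tagged half (marginals of all orders, union over
`⌈yK'⌉`-clusters, exponential kinetic moment, geometric series over scales `K' ≥ K`) is open.

§0 is a VERBATIM FALLBACK COPY of the vocabulary of `…PlaqueSplit` (p128811, landed, not yet built on the farm) and
`…PlaqueSplitDilute` §1' (lead, not yet landed); it is to be replaced by the two imports and `open …CollisionActivityTailsPlaqueSplit`
at landing (`stub_abnormalActivityVanishes.import_form.lean`).

References: C. Cercignani, R. Illner, M. Pulvirenti, *The Mathematical Theory of Dilute Gases* (1994), §4.3, App. 4.A; I. Gallagher,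
L. Saint-Raymond, B. Texier, *From Newton to Boltzmann* (2013), Ch. 4. Bookkeeping only.
-/

noncomputable section

open MeasureTheory Set Filter Topology
open scoped ENNReal

namespace Summit.AtomisticToContinuum.HydrodynamicLimit.Theorems.CollisionActivityTailsAbnormalActivity

open Literature.MathematicalPhysics.KineticTheory Literature.Analysis.FluidPDE
open Summit.AtomisticToContinuum.HydrodynamicLimit.Theorems.CollisionActivityTailsActivityDomination
  (Flow Cfg window act tdist nearCount collisionPairSum_nonneg window_pos)
open Summit.AtomisticToContinuum.HydrodynamicLimit.Theorems.CollisionActivityTailsEndpointTails (ae_mem_good_localGibbsLaw)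

/-! ## §0 FALLBACK VOCABULARY — verbatim from `…Theorems.CollisionActivityTailsPlaqueSplit` (p128811) and `…PlaqueSplitDilute` §1'
(lead, not landed); to be replaced by the two imports + `open …CollisionActivityTailsPlaqueSplit` at landing. -/

section Fallback

variable {σ : ℝ} {N : ℕ}

/-- The collision record of the ordered pair `(k, l)` read off the (post-collisional) configuration `y` at time `t`. -/
abbrev rec (σ : ℝ) (N : ℕ) (y : Cfg N) (t : ℝ) (k l : Fin (N + 1)) : HardSphereCollisionRecord (Fin 3) T3 (N + 1) :=
  HardSphereCollisionRecord.ofConfig (Torus.geometry (Fin 3)) (hsDiameter σ N) y t k l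

/-- The impulse `|v_k⁺ - v_k⁻|` received by the first particle of the ordered contact pair `(k, l)` (the crux's summand). -/
def imp (σ : ℝ) (N : ℕ) (y : Cfg N) (t : ℝ) (k l : Fin (N + 1)) : ℝ :=
  ‖(rec σ N y t k l).postVel.1 - (rec σ N y t k l).preVel.1‖

/-- Relative speed of the pair `(k, l)` in the configuration `y` (equal in norm before and after an elastic collision). -/
def relSpeed (y : Cfg N) (k l : Fin (N + 1)) : ℝ := ‖(y k).2 - (y l).2‖

/-- Radius of the ball of MEAN occupancy `K'` (unit torus, `N + 1` centres): `(4π/3) r³ (N+1) = K'`. -/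
def scaleRadius (N K' : ℕ) : ℝ := (3 * (K' : ℝ) / (4 * Real.pi * ((N : ℝ) + 1))) ^ (1 / 3 : ℝ)

/-- Kinetic energy (twice) carried by the centres within distance `r` of particle `i` (itself included). -/
def ballKinetic (y : Cfg N) (i : Fin (N + 1)) (r : ℝ) : ℝ :=
  ∑ j : Fin (N + 1), if tdist (y j).1 (y i).1 ≤ r then ‖(y j).2‖ ^ 2 else 0

/-- Particle `i` is **tagged** (threshold `y`, minimal scale `K`) in the configuration `cfg` (verbatim, PlaqueSplit). -/
def Tagged (y : ℝ) (K : ℕ) (cfg : Cfg N) (i : Fin (N + 1)) : Prop :=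
  ∃ K' : ℕ, K ≤ K' ∧ 1 ≤ K' ∧
    (y * K' ≤ (nearCount cfg i (scaleRadius N K') : ℝ) ∨ y * K' ≤ ballKinetic cfg i (scaleRadius N K'))

open scoped Classical in
/-- **Tagged cold activity** `tagAct` (verbatim, PlaqueSplit). -/
def tagAct (Θ y : ℝ) (K : ℕ) (Φ : Flow σ N) (τ s : ℝ) (i : Fin (N + 1)) (z : Cfg N) : ℝ :=
  σ / τ * Φ.collisionPairSum (Set.Ioc s (s + window τ N))
    (fun t cfg k l => if k = i ∧ relSpeed cfg k l ≤ Θ ∧ Tagged y K cfg i then imp σ N cfg t k l else 0) z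

open scoped Classical in
/-- **Hot activity** `hotAct` (verbatim, PlaqueSplit). -/
def hotAct (Θ : ℝ) (Φ : Flow σ N) (τ s : ℝ) (i : Fin (N + 1)) (z : Cfg N) : ℝ :=
  σ / τ * Φ.collisionPairSum (Set.Ioc s (s + window τ N))
    (fun t cfg k l => if k = i ∧ ¬ relSpeed cfg k l ≤ Θ then imp σ N cfg t k l else 0) z

/-- **Envelope on a horizon** (verbatim, PlaqueSplitDilute §1'): Gaussian-weighted a.e. bounds `|f^{(k)}_{N}(r)| ≤ C^k e^{-β E_k}`
of all bounded-order volume-marginals of `𝟙_D · (W_N ∘ Φ_{-r})` for `r ∈ [0, t₁]`, for ONE profile triple, ONE reduced diameter and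
ONE flow family. -/
def EnvelopeOn (σ : ℝ) (a₀ θ₀ : T3 → ℝ) (u₀ : T3 → V3) (Φ : (N : ℕ) → Flow σ N) (t₁ β C : ℝ) : Prop :=
  ∀ (N k : ℕ), ∀ r ∈ Set.Icc 0 t₁, ∀ᵐ Zk : Config k (Fin 3) T3,
    |nthMarginal (N + 1) k ((hardSphereDomain (Torus.geometry (Fin 3)) (N + 1) (hsDiameter σ N)).indicator
        (hsTransport (Φ N) r (canonicalDensity (Torus.geometry (Fin 3)) (hsDiameter σ N) (N + 1)
          (localGibbsProfile a₀ u₀ θ₀)))) Zk| ≤ C ^ k * Real.exp (-(β * configEnergy Zk))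

/-- **The abnormal-mean bound for ONE profile triple / diameter / flow family on the horizon `t`** (verbatim, PlaqueSplitDilute §1'),
with the dense-phase range `y₀ · σ³ ≤ 1` of the tagging threshold. -/
def AbnormalSmallOn (σ : ℝ) (a₀ θ₀ : T3 → ℝ) (u₀ : T3 → V3) (Φ : (N : ℕ) → Flow σ N) (t : ℝ) : Prop :=
  ∃ y₀ : ℝ, 0 < y₀ ∧ y₀ * σ ^ 3 ≤ 1 ∧ ∀ y : ℝ, y₀ ≤ y → ∀ η : ℝ, 0 < η →
    ∃ Θ : ℝ, 0 < Θ ∧ ∃ K : ℕ, ∀ τ : ℝ, 0 < τ → ∃ N₀ : ℕ, ∀ N : ℕ, N₀ ≤ N → ∀ s ∈ Set.Icc 0 t,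
      ∫⁻ z, ENNReal.ofReal (((N : ℝ) + 1)⁻¹ *
          ∑ i : Fin (N + 1), (tagAct Θ y K (Φ N) τ s i z + hotAct Θ (Φ N) τ s i z))
        ∂(localGibbsLaw σ a₀ u₀ θ₀ N (Φ N)) ≤ ENNReal.ofReal η

/-- **STUB 5' — ABNORMAL ACTIVITY FROM A DILUTE ENVELOPE, LOCALLY** (verbatim, PlaqueSplitDilute §1'). -/
def AbnormalFromEnvelope : Prop :=
  ∀ (a₀ θ₀ : T3 → ℝ) (u₀ : T3 → V3), Continuous a₀ → Continuous θ₀ → Continuous u₀ →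
    (∀ x, 0 < a₀ x) → (∀ x, 0 < θ₀ x) → ∃ κ₅ : ℝ, 0 < κ₅ ∧ ∃ σ₅ : ℝ, 0 < σ₅ ∧ ∀ σ : ℝ, 0 < σ → σ < σ₅ →
    ∀ (Φ : (N : ℕ) → Flow σ N) (t t₁ β C : ℝ), 0 ≤ t → t < t₁ → 0 < β → 0 ≤ C →
      C * (2 * Real.pi / β) ^ (3 / 2 : ℝ) * σ ^ 3 * max 1 β⁻¹ ≤ κ₅ →
      EnvelopeOn σ a₀ θ₀ u₀ Φ t₁ β C → AbnormalSmallOn σ a₀ θ₀ u₀ Φ t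

/-- The two abnormal pieces of the activity are nonnegative (`σ, τ ≥ 0`; the impulse is a norm). -/
theorem tagAct_nonneg_and_hotAct_nonneg (hσ : 0 ≤ σ) {Θ y : ℝ} {K : ℕ} (Φ : Flow σ N) {τ : ℝ} (hτ : 0 ≤ τ) (s : ℝ)
    (i : Fin (N + 1)) (z : Cfg N) : 0 ≤ tagAct Θ y K Φ τ s i z ∧ 0 ≤ hotAct Θ Φ τ s i z := by
  classical
  unfold tagAct hotAct
  refine ⟨mul_nonneg (div_nonneg hσ hτ) (collisionPairSum_nonneg Φ _ (fun t cfg k l => ?_) z),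
    mul_nonneg (div_nonneg hσ hτ) (collisionPairSum_nonneg Φ _ (fun t cfg k l => ?_) z)⟩
  · split_ifs
    · exact norm_nonneg _
    · exact le_rfl
  · split_ifs
    · exact norm_nonneg _
    · exact le_rfl

end Fallback

/-! ## §2 The two marked fluxes of the abnormal activity: local statements (one profile triple, diameter, flow family, horizon) -/

section Statements

variable {σ : ℝ}

/-- **HOT ACTIVITY SMALL IN MEAN on the horizon `t`** (the two-point flux half of `AbnormalSmallOn`): for every accuracy `η`
there is a cold cap `Θ` with: for EVERY `τ > 0`, `N ≥ N₀(τ)` and all starts `s ≤ t`, the normalised hot activity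
`(N+1)⁻¹ Σ_i hotAct_i` is dominated a.e. under the local Gibbs law by a MEASURABLE function of mean `≤ η` — the shape delivered by
the window inequality of §1, whose grid majorant is measurable while the collision sum itself need not be; it lets one `lintegral`
be split in `abnormalSmallOn_of_hot_of_tagged` without any measurability of the tagged sum. Mechanism:
`Σ_i hotAct_i = (σ/τ) Σ_{collisions (k,l) in (s,s+w]} 𝟙{|v_k - v_l| > Θ} |Δv_k|`, `|Δv_k| ≤ |v_k - v_l|` (a mark of the two
velocities, unchanged by free flight), so its mean is at most `w ×` the two-point contact flux of `|g|² 𝟙{|g| > Θ}` under the laws at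
times `r ∈ [s, s+w] ⊆ [0, t₁]`, i.e. `(N+1)⁻¹ E Σ_i hotAct_i ≤ 4 σ³ C² ∫∫_{|v-w|>Θ} |v-w|² e^{-β(|v|²+|w|²)/2}` under an envelope
with constants `(β, C)` on `[0, t₁]` — Gaussian-small in `Θ`, uniformly in `τ` (`(σ/τ) · w · (N+1)² ε² = σ³ (N+1)`); no diluteness
is needed for this half. -/
def HotSmallOn (σ : ℝ) (a₀ θ₀ : T3 → ℝ) (u₀ : T3 → V3) (Φ : (N : ℕ) → Flow σ N) (t : ℝ) : Prop :=
  ∀ η : ℝ, 0 < η → ∃ Θ : ℝ, 0 < Θ ∧ ∀ τ : ℝ, 0 < τ → ∃ N₀ : ℕ, ∀ N : ℕ, N₀ ≤ N → ∀ s ∈ Set.Icc 0 t,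
    ∃ g : Cfg N → ℝ≥0∞, Measurable g ∧
      (∀ᵐ z ∂(localGibbsLaw σ a₀ u₀ θ₀ N (Φ N)),
        ENNReal.ofReal (((N : ℝ) + 1)⁻¹ * ∑ i : Fin (N + 1), hotAct Θ (Φ N) τ s i z) ≤ g z) ∧
      ∫⁻ z, g z ∂(localGibbsLaw σ a₀ u₀ θ₀ N (Φ N)) ≤ ENNReal.ofReal η

/-- **TAGGED COLD ACTIVITY SMALL IN MEAN on the horizon `t`** (the multi-point flux half of `AbnormalSmallOn`), with the dense-phase
range `y₀ · σ³ ≤ 1` of the delivered tagging threshold: there is `y₀` such that for `y ≥ y₀`, every cold cap `Θ > 0` and every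
accuracy `η` there is a minimal tagging scale `K` with: for EVERY `τ > 0`, `N ≥ N₀(τ)` and all starts `s ≤ t`,
`E_{λ₀}[(N+1)⁻¹ Σ_i tagAct_i] ≤ η`. Mechanism: `Σ_i tagAct_i ≤ (σ/τ) Σ_{collisions (k,l) in (s,s+w]} 𝟙{Tagged y K · k} |v_k - v_l|`;
the count tag at scale `K'` is a union of `⌈yK'⌉`-point events and the kinetic tag is priced by an exponential moment expanded in
bounded-order marginals, so the window inequality of §1 and an envelope `C^k e^{-β E_k}` of ALL orders on `[0, t₁]` give per scale
the bound `≲ σ³ (C c_β)² [(e C c_β / y)^{y K'} + e^{-K'(β y/4 - 2^{3/2} C c_β)}]`, `c_β = (2π/β)^{3/2}`, geometric in `K'` once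
`y ≥ y₀ := C c_β · max (2e) (12/β)`, summed over `K' ≥ max K 1`; `y₀ σ³ ≤ 1` is then the diluteness demand
`C c_β σ³ · max (2e) (12/β) ≤ 1` on the envelope constants. (`K` may depend on `Θ`; the cap only helps.) -/
def TaggedSmallOn (σ : ℝ) (a₀ θ₀ : T3 → ℝ) (u₀ : T3 → V3) (Φ : (N : ℕ) → Flow σ N) (t : ℝ) : Prop :=
  ∃ y₀ : ℝ, 0 < y₀ ∧ y₀ * σ ^ 3 ≤ 1 ∧ ∀ y : ℝ, y₀ ≤ y → ∀ Θ : ℝ, 0 < Θ → ∀ η : ℝ, 0 < η →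
    ∃ K : ℕ, ∀ τ : ℝ, 0 < τ → ∃ N₀ : ℕ, ∀ N : ℕ, N₀ ≤ N → ∀ s ∈ Set.Icc 0 t,
      ∫⁻ z, ENNReal.ofReal (((N : ℝ) + 1)⁻¹ * ∑ i : Fin (N + 1), tagAct Θ y K (Φ N) τ s i z)
        ∂(localGibbsLaw σ a₀ u₀ θ₀ N (Φ N)) ≤ ENNReal.ofReal η

/-- **HOT HALF FROM AN ENVELOPE, LOCALLY** (sub-goal): for continuous positive profiles there is `σ₅` such that for `0 < σ < σ₅`,
every flow family and every `0 ≤ t < t₁`, an envelope on `[0, t₁]` with ANY constants `β > 0`, `C ≥ 0` gives `HotSmallOn` on the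
horizon `t` (two-point marginals only; the cap `Θ` is chosen after `σ, β, C`). -/
def HotFromEnvelope : Prop :=
  ∀ (a₀ θ₀ : T3 → ℝ) (u₀ : T3 → V3), Continuous a₀ → Continuous θ₀ → Continuous u₀ →
    (∀ x, 0 < a₀ x) → (∀ x, 0 < θ₀ x) → ∃ σ₅ : ℝ, 0 < σ₅ ∧ ∀ σ : ℝ, 0 < σ → σ < σ₅ →
    ∀ (Φ : (N : ℕ) → Flow σ N) (t t₁ β C : ℝ), 0 ≤ t → t < t₁ → 0 < β → 0 ≤ C →
      EnvelopeOn σ a₀ θ₀ u₀ Φ t₁ β C → HotSmallOn σ a₀ θ₀ u₀ Φ t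

/-- **TAGGED HALF FROM A DILUTE ENVELOPE, LOCALLY** (sub-goal, typed against the diluteness clause of `AbnormalFromEnvelope`):
for continuous positive profiles there are `κ₅` and `σ₅` such that for `0 < σ < σ₅`, every flow family and every `0 ≤ t < t₁`, an
envelope on `[0, t₁]` with constants `C (2π/β)^{3/2} σ³ · max 1 β⁻¹ ≤ κ₅` gives `TaggedSmallOn` on the horizon `t`. NOTE (see the module
docstring and the work log): the kinetic-tag series needs `y₀ ≥ 12 C (2π/β)^{3/2} / β`, so `y₀ σ³ ≤ 1` follows from this clause only
for `β` bounded below, which is why the clause (lead's reshape v5) carries the factor `max 1 β⁻¹`. -/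
def TaggedFromEnvelope : Prop :=
  ∀ (a₀ θ₀ : T3 → ℝ) (u₀ : T3 → V3), Continuous a₀ → Continuous θ₀ → Continuous u₀ →
    (∀ x, 0 < a₀ x) → (∀ x, 0 < θ₀ x) → ∃ κ₅ : ℝ, 0 < κ₅ ∧ ∃ σ₅ : ℝ, 0 < σ₅ ∧ ∀ σ : ℝ, 0 < σ → σ < σ₅ →
    ∀ (Φ : (N : ℕ) → Flow σ N) (t t₁ β C : ℝ), 0 ≤ t → t < t₁ → 0 < β → 0 ≤ C →
      C * (2 * Real.pi / β) ^ (3 / 2 : ℝ) * σ ^ 3 * max 1 β⁻¹ ≤ κ₅ →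
      EnvelopeOn σ a₀ θ₀ u₀ Φ t₁ β C → TaggedSmallOn σ a₀ θ₀ u₀ Φ t

end Statements

/-! ## §3 The reductions -/

section Reduction

variable {σ : ℝ} {a₀ θ₀ : T3 → ℝ} {u₀ : T3 → V3} {Φ : (N : ℕ) → Flow σ N} {t : ℝ}

/-- **REDUCTION on a horizon.** The hot half and the tagged half give `AbnormalSmallOn` (quantifier bookkeeping: `y₀` with its
dense-phase range from the tagged half; given `y ≥ y₀` and `η`, the cap `Θ` from the hot half at accuracy `η/2`, then `K` from the
tagged half at `(y, Θ, η/2)`; `N₀ = max`; pointwise `ofReal(c(tag + hot)) = ofReal(c tag) + ofReal(c hot) ≤ ofReal(c tag) + g`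
a.e., one `lintegral` split by the measurability of the hot majorant `g`, `η/2 + η/2 = η`). -/
theorem abnormalSmallOn_of_hot_of_tagged (hσ : 0 ≤ σ) (hH : HotSmallOn σ a₀ θ₀ u₀ Φ t)
    (hT : TaggedSmallOn σ a₀ θ₀ u₀ Φ t) : AbnormalSmallOn σ a₀ θ₀ u₀ Φ t := by
  obtain ⟨y₀, hy₀, hyσ, hT⟩ := hT
  refine ⟨y₀, hy₀, hyσ, fun y hy η hη => ?_⟩
  have hη2 : 0 < η / 2 := by positivity
  obtain ⟨Θ, hΘ, hH⟩ := hH (η / 2) hη2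
  obtain ⟨K, hT⟩ := hT y hy Θ hΘ (η / 2) hη2
  refine ⟨Θ, hΘ, K, fun τ hτ => ?_⟩
  obtain ⟨N₁, hH⟩ := hH τ hτ
  obtain ⟨N₂, hT⟩ := hT τ hτ
  refine ⟨max N₁ N₂, fun N hN s hs => ?_⟩
  obtain ⟨g, hgm, hdom, hHb⟩ := hH N (le_of_max_le_left hN) s hs
  have hTb := hT N (le_of_max_le_right hN) s hs
  set P := localGibbsLaw σ a₀ u₀ θ₀ N (Φ N) with hP
  have hN1 : (0 : ℝ) ≤ ((N : ℝ) + 1)⁻¹ := inv_nonneg.2 (by positivity)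
  have hae : ∀ᵐ z ∂P, ENNReal.ofReal (((N : ℝ) + 1)⁻¹ *
      ∑ i : Fin (N + 1), (tagAct Θ y K (Φ N) τ s i z + hotAct Θ (Φ N) τ s i z)) ≤
      ENNReal.ofReal (((N : ℝ) + 1)⁻¹ * ∑ i : Fin (N + 1), tagAct Θ y K (Φ N) τ s i z) + g z := by
    filter_upwards [hdom] with z hz
    rw [Finset.sum_add_distrib, mul_add, ENNReal.ofReal_add
      (mul_nonneg hN1 (Finset.sum_nonneg fun i _ =>
        (tagAct_nonneg_and_hotAct_nonneg hσ (Θ := Θ) (y := y) (K := K) (Φ N) hτ.le s i z).1))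
      (mul_nonneg hN1 (Finset.sum_nonneg fun i _ =>
        (tagAct_nonneg_and_hotAct_nonneg hσ (Θ := Θ) (y := y) (K := K) (Φ N) hτ.le s i z).2))]
    exact add_le_add le_rfl hz
  calc _ ≤ ∫⁻ z, ENNReal.ofReal (((N : ℝ) + 1)⁻¹ * ∑ i : Fin (N + 1), tagAct Θ y K (Φ N) τ s i z) + g z ∂P :=
        lintegral_mono_ae hae
    _ = ∫⁻ z, ENNReal.ofReal (((N : ℝ) + 1)⁻¹ * ∑ i : Fin (N + 1), tagAct Θ y K (Φ N) τ s i z) ∂P +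
          ∫⁻ z, g z ∂P := lintegral_add_right' _ hgm.aemeasurable
    _ ≤ ENNReal.ofReal (η / 2) + ENNReal.ofReal (η / 2) := add_le_add hTb hHb
    _ = ENNReal.ofReal η := by rw [← ENNReal.ofReal_add hη2.le hη2.le, add_halves]

end Reduction

/-- **REDUCTION of stub 5' to its two halves.** `HotFromEnvelope` and `TaggedFromEnvelope` give `AbnormalFromEnvelope`
(`κ₅` from the tagged half, `σ₅ = min`, then `abnormalSmallOn_of_hot_of_tagged`). -/
theorem stub_abnormalFromEnvelope_of_hot_of_tagged : HotFromEnvelope → TaggedFromEnvelope → AbnormalFromEnvelope := by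
  intro hH hT a₀ θ₀ u₀ ha hθ hu ha0 hθ0
  obtain ⟨σ₁, hσ₁, hH⟩ := hH a₀ θ₀ u₀ ha hθ hu ha0 hθ0
  obtain ⟨κ₅, hκ₅, σ₂, hσ₂, hT⟩ := hT a₀ θ₀ u₀ ha hθ hu ha0 hθ0
  refine ⟨κ₅, hκ₅, min σ₁ σ₂, lt_min hσ₁ hσ₂, fun σ hσ hσlt Φ t t₁ β C ht htt₁ hβ hC hdil hE => ?_⟩
  exact abnormalSmallOn_of_hot_of_tagged hσ.le
    (hH σ hσ (hσlt.trans_le (min_le_left _ _)) Φ t t₁ β C ht htt₁ hβ hC hE)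
    (hT σ hσ (hσlt.trans_le (min_le_right _ _)) Φ t t₁ β C ht htt₁ hβ hC hdil hE)

end Summit.AtomisticToContinuum.HydrodynamicLimit.Theorems.CollisionActivityTailsAbnormalActivity

end
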